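import Summits.ResolutionOfSingularities.ResolutionOfSingularities.Theorems.FrobeniusClosingPatchingRelPerfectMonomialRouteKStepReadings
import HarnessLib

/-!
# Crux `PatchingRelPerfect` (stmt-ResolutionOfSingularities-16161), chain w52 — TargetsF3 (m)
# «M2-strong», COMBINATORIAL HALF, Route K step K14: (IMG) at the next level — a new chart is exactly
# the set of points all of whose new boundary divisors are labelled in its cone

[OURS · L1 W5.2 · design memo v3 (`L/res-type-075/M2STRONG-COMBINATORIAL-HALF.md`); fact-free;
nothing here is a statement of the manuscript under review]

**`Good.newCharts_mem_U_iff`.**  (→) a divisor not labelled in the new cone is read as `⊤`, so misses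
the chart (file K13b).  (←) for `y'` all of whose new divisors are labelled in the cone of the new chart
`c'` over the old chart `c`: read `y'` in SOME new chart over an old chart `c₀ ∋ π y'` (they cover,
files K11/K13a); there the pull-back of an old divisor `D_l` through `π y'` factors through the strict
transform of `D_l` or through the exceptional piece over the component seen by `c₀`, so `l` or that
component's name is labelled in the cone of `c'`; as names of different components differ, every old
divisor through `π y'` is labelled in the OLD cone of `c`, i.e. `π y' ∈ U_c` (IMG at the old level);
finally the chart transition of file K11 moves `y'` into the `j`-chart, because the strict transform of
`V(x_j)` — read as `(x_j)` in the other charts of the family — does not pass through `y'`.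
-/

-- `Summit.<Summit>.<Sub>.Theorems` with `Sub = Summit` (single-conjunct summit, D-0017)
set_option linter.dupNamespace false

noncomputable section

open CategoryTheory AlgebraicGeometry TopologicalSpace MvPolynomial
open Literature.AlgebraicGeometry.Resolution

namespace Summit.ResolutionOfSingularities.ResolutionOfSingularities.Theorems

namespace PolyhedraGame

namespace RouteK

variable {L : Finset ℕ} {m : ℕ} {s : State} {Y : Scheme.{0}} {D : ℕ → Y.IdealSheafData} {M : MarkedIdeal Y}
  {C : Y.IdealSheafData} {rest : CentreSeq (blowup C)} {𝒞 : Set (Chart L Y)}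

/-- [OURS] A point of a chart defined by an open immersion misses every ideal sheaf read as `⊤`. -/
theorem Chart.not_mem_support_of_img_eq_top {Y' : Scheme.{0}} (lab : ℕ → ℕ) (g : Spec (Rc L) ⟶ Y')
    [IsOpenImmersion g] {K : Y'.IdealSheafData} (hK : (Chart.ofMap lab g).img K = ⊤) {y : Y'}
    (hy : y ∈ ((Chart.ofMap lab g).U : Y'.Opens)) : y ∉ K.support := by
  rw [Chart.mem_ofMap_U_iff] at hy
  obtain ⟨z, rfl⟩ := hy
  rw [Chart.ofMap_mem_support_iff, hK, top_le_iff]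
  exact z.2.ne_top

section Img

variable (G : Good L m s Y D M (CentreSeq.cons C rest) 𝒞) (hm : 1 ≤ m) (hs : s.WF)
  {mv : List (Finset ℕ × ℕ)} (hmv : BlockPlay m s G.components mv)
include G hm hs hmv

/-- [OURS] (→) of (IMG) at the next level: the new divisors through a point of a new chart are labelled in
its cone. -/
theorem Good.mem_cone_of_mem_newU {c' : Chart L (blowup C)} (hc' : c' ∈ newCharts 𝒞 C mv)
    {y' : blowup C} (hy' : y' ∈ (c'.U : (blowup C).Opens)) {l : ℕ} (hl : y' ∈ (newD s D C mv l).support) :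
    l ∈ c'.cone := by
  by_contra hlc
  have htop := G.img_newD_top hm hs hmv hc' hlc
  rcases hc' with ⟨c, hc, S, hS, j, e, hJe, rfl⟩ | ⟨c, hc, htop', rfl⟩
  · haveI := (famMap_spec c S hS).1 j
    exact Chart.not_mem_support_of_img_eq_top _ (famMap c S hS j) htop hy' hl
  · haveI := (liftMap_spec c htop').1
    exact Chart.not_mem_support_of_img_eq_top _ (liftMap c htop') htop hy' hl

/-- [OURS] **Key step of (←)**: if all new divisors through `y'` are labelled in the cone of a new chart over
`c`, then all old divisors through `π y'` are labelled in the cone of `c`. -/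
theorem Good.mem_cone_of_forall_newD {c' : Chart L (blowup C)} (hc' : c' ∈ newCharts 𝒞 C mv)
    {c : Chart L Y} (hcc' : (∃ S hS j e, (c.labels S, e) ∈ mv ∧ c' = famChart c S hS j e) ∨ ∃ htop, c' = liftChart c htop)
    (hc : c ∈ 𝒞) {y' : blowup C} (H : ∀ l, y' ∈ (newD s D C mv l).support → l ∈ c'.cone)
    {l : ℕ} (hl : blowup.π C y' ∈ (D l).support) : l ∈ c.cone := by
  haveI := G.locNoeth
  haveI : IsLocallyNoetherian (blowup C) := CentreSeq.isLocallyNoetherian_blowup C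
  -- `l` is live
  have hlB : l ∈ s.B := by
    by_contra h
    rw [G.D_top l h, Scheme.IdealSheafData.support_top] at hl
    exact (show (blowup.π C y') ∈ ((⊥ : TopologicalSpace.Closeds Y) : Set Y) from hl)
  -- old labels in the new cone of `c'` lie in the cone of `c`
  have hold : ∀ l ∈ s.B, l ∈ c'.cone → l ∈ c.cone := by
    intro l hlB hl
    rcases hcc' with ⟨S, hS, j, e, hJe, rfl⟩ | ⟨htop, rfl⟩
    · rw [cone_famChart c (G.lab_inj c hc) S hS j e, Finset.mem_insert, Finset.mem_erase] at hl
      rcases hl with rfl | ⟨-, hl⟩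
      · exact absurd hlB (G.name_not_mem_B hm hs hmv hJe)
      · exact hl
    · exact hl
  -- a name in the new cone of `c'` is the name of the component seen by `c`, which lies in the cone of `c`
  have hname : ∀ p ∈ mv, p.2 ∈ c'.cone → p.1 ⊆ c.cone := by
    intro p hp hpc
    rcases hcc' with ⟨S, hS, j, e, hJe, rfl⟩ | ⟨htop, rfl⟩
    · rw [cone_famChart c (G.lab_inj c hc) S hS j e, Finset.mem_insert, Finset.mem_erase] at hpc
      rcases hpc with hpe | ⟨-, hpc⟩
      · have := BlockPlay.eq_of_snd_eq hmv p hp _ hJe hpe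
        rw [this]
        exact c.labels_subset_cone S
      · exact absurd (hs.str_subset _ (G.cone_mem c hc) hpc) (G.name_not_mem_B hm hs hmv hp)
    · exact absurd (hs.str_subset _ (G.cone_mem c hc) hpc) (G.name_not_mem_B hm hs hmv hp)
  -- read `y'` in a new chart over an old chart `c₀ ∋ π y'`
  obtain ⟨c₀, hc₀, hy⟩ := G.cov_pts (blowup.π C y')
  have hl₀ : l ∈ c₀.cone := (G.mem_U_iff c₀ hc₀ _).mp hy l hl
  obtain ⟨b₀, hb₀L, hb₀⟩ := Finset.mem_image.mp hl₀
  obtain ⟨b, rfl⟩ : ∃ b : L, c₀.lab b = l := ⟨⟨b₀, hb₀L⟩, hb₀⟩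
  have hy'comap : y' ∈ ((D (c₀.lab b)).comap (blowup.π C)).support := by
    rw [Scheme.IdealSheafData.support_comap]; exact hl
  rcases G.exists_sees_or_top hm hs hc₀ with htop₀ | ⟨J₀, S₀, -, hS₀, rfl⟩
  · -- lifted chart over `c₀`: the strict transform reads as the divisor did
    haveI := (liftMap_spec c₀ htop₀).1
    have hg₀ := (liftMap_spec c₀ htop₀).2.1
    obtain ⟨z, rfl⟩ := (liftMap_spec c₀ htop₀).2.2 y' hy
    have h1 := (Chart.ofMap_mem_support_iff c₀.lab (liftMap c₀ htop₀) _ z).mp hy'comap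
    rw [img_lift_comap c₀ c₀.lab (liftMap c₀ htop₀) hg₀, G.img_D c₀ hc₀ b] at h1
    have h2 : (liftMap c₀ htop₀) z ∈ (newD s D C mv (c₀.lab b)).support := by
      rw [Chart.ofMap_mem_support_iff c₀.lab, newD_of_mem D C mv hlB, img_lift_strict c₀ htop₀ c₀.lab _ hg₀,
        G.img_D c₀ hc₀ b]
      exact h1
    exact hold _ hlB (H _ h2)
  · -- a chart of the family over `c₀`, say the `i`-chart, contains `y'`
    obtain ⟨e₀, hJe₀⟩ := G.exists_name_of_img_eq hm hs hmv hc₀ hS₀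
    obtain ⟨i, z, rfl⟩ := (famMap_spec c₀ S₀ hS₀).2.2.1 y' hy
    haveI := (famMap_spec c₀ S₀ hS₀).1 i
    have hg₀ := (famMap_spec c₀ S₀ hS₀).2.1 i
    have hfc : famChart c₀ S₀ hS₀ i e₀ ∈ newCharts 𝒞 C mv := Or.inl ⟨c₀, hc₀, S₀, hS₀, i, e₀, hJe₀, rfl⟩
    -- the pull-back of `D_l` reads `(subst_i x_b)`
    have h1 := (Chart.ofMap_mem_support_iff (Function.update c₀.lab i e₀) (famMap c₀ S₀ hS₀ i) _ z).mp hy'comap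
    rw [Chart.img_ofMap_comap c₀ _ (famMap c₀ S₀ hS₀ i) _ hg₀, G.img_D c₀ hc₀ b, Ideal.map_span, Set.image_singleton,
      Ideal.span_singleton_le_iff_mem] at h1
    -- readings of the new divisors in the `i`-chart
    have hexc : (famChart c₀ S₀ hS₀ i e₀).img (newD s D C mv e₀) = Ideal.span {MvPolynomial.X (i : L)} := by
      have := G.img_newD hm hs hmv hfc (i : L)
      rwa [famChart_lab_self] at this
    have hstrict : ∀ b' : L, b' ≠ (i : L) →
        (famChart c₀ S₀ hS₀ i e₀).img (newD s D C mv (c₀.lab b')) = Ideal.span {MvPolynomial.X b'} := by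
      intro b' hb'
      have := G.img_newD hm hs hmv hfc b'
      rwa [famChart_lab_of_ne c₀ S₀ hS₀ i e₀ hb'] at this
    -- case analysis on the variable `b`
    by_cases hXi : (MvPolynomial.X (i : L) : MvPolynomial L ℚ) ∈ z.asIdeal
    · -- `y'` lies on the exceptional piece over `labels S₀`: its name is in the cone of `c'`
      have h2 : famMap c₀ S₀ hS₀ i z ∈ (newD s D C mv e₀).support := by
        rw [Chart.ofMap_mem_support_iff (Function.update c₀.lab i e₀), ← famChart, hexc,
          Ideal.span_singleton_le_iff_mem]
        exact hXi
      have hJ₀c : c₀.labels S₀ ⊆ c.cone := hname _ hJe₀ (H _ h2)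
      -- hence `c` sees `labels S₀` too and `l ∈ labels S₀` or `l` is read through the strict transform
      by_cases hbS : b ∈ S₀
      · exact hJ₀c (Finset.mem_image_of_mem _ hbS)
      · -- `b ∉ S₀`: `subst_i x_b = x_b`, and the strict transform of `D_l` reads `(x_b)`
        rw [AlgHom.toRingHom_eq_coe, AlgHom.coe_toRingHom,
          coordBlowupSubst_X_of_not_mem ℚ (S₀ : Set L) _ (fun h => hbS (Finset.mem_coe.mp h))] at h1
        have hbi : b ≠ (i : L) := fun h => hbS (h ▸ i.2)
        have h2 : famMap c₀ S₀ hS₀ i z ∈ (newD s D C mv (c₀.lab b)).support := by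
          rw [Chart.ofMap_mem_support_iff (Function.update c₀.lab i e₀), ← famChart, hstrict b hbi,
            Ideal.span_singleton_le_iff_mem]
          exact h1
        exact hold _ hlB (H _ h2)
    · -- `x_i ∉ z`: then `x_b ∈ z` and `b ≠ i`, and the strict transform of `D_l` reads `(x_b)`
      have hbi : b ≠ (i : L) := by
        rintro rfl
        rw [AlgHom.toRingHom_eq_coe, AlgHom.coe_toRingHom, coordBlowupSubst_X_self] at h1
        exact hXi h1
      have hXb : (MvPolynomial.X b : MvPolynomial L ℚ) ∈ z.asIdeal := by
        rw [AlgHom.toRingHom_eq_coe, AlgHom.coe_toRingHom] at h1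
        by_cases hbS : b ∈ S₀
        · rw [coordBlowupSubst_X_of_mem_of_ne ℚ (S₀ : Set L) _ (Finset.mem_coe.mpr hbS) hbi] at h1
          exact (z.2.mem_or_mem h1).resolve_left hXi
        · rwa [coordBlowupSubst_X_of_not_mem ℚ (S₀ : Set L) _ (fun h => hbS (Finset.mem_coe.mp h))] at h1
      have h2 : famMap c₀ S₀ hS₀ i z ∈ (newD s D C mv (c₀.lab b)).support := by
        rw [Chart.ofMap_mem_support_iff (Function.update c₀.lab i e₀), ← famChart, hstrict b hbi,
          Ideal.span_singleton_le_iff_mem]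
        exact hXb
      exact hold _ hlB (H _ h2)

/-- [OURS · Route K] **(IMG) at the next level.** -/
theorem Good.newCharts_mem_U_iff {c' : Chart L (blowup C)} (hc' : c' ∈ newCharts 𝒞 C mv)
    (y' : blowup C) :
    y' ∈ (c'.U : (blowup C).Opens) ↔ ∀ l, y' ∈ (newD s D C mv l).support → l ∈ c'.cone := by
  refine ⟨fun hy' l hl => G.mem_cone_of_mem_newU hm hs hmv hc' hy' hl, fun H => ?_⟩
  rcases hc' with ⟨c, hc, S, hS, j, e, hJe, rfl⟩ | ⟨c, hc, htop, rfl⟩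
  · have hcc' : (∃ S' hS' j' e', (c.labels S', e') ∈ mv ∧ famChart c S hS j e = famChart c S' hS' j' e') ∨
        ∃ htop, famChart c S hS j e = liftChart c htop := Or.inl ⟨S, hS, j, e, hJe, rfl⟩
    -- `π y' ∈ U_c`
    have hy : blowup.π C y' ∈ (c.U : Y.Opens) :=
      (G.mem_U_iff c hc _).mpr fun l hl => G.mem_cone_of_forall_newD hm hs hmv
        (Or.inl ⟨c, hc, S, hS, j, e, hJe, rfl⟩) hcc' hc H hl
    -- `y'` lies in some chart `i` of the family; move it to the `j`-chart
    obtain ⟨i, z, rfl⟩ := (famMap_spec c S hS).2.2.1 y' hy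
    haveI := (famMap_spec c S hS).1 j
    haveI := (famMap_spec c S hS).1 i
    rw [famChart, Chart.mem_ofMap_U_iff]
    by_cases hij : i = j
    · subst hij; exact ⟨z, rfl⟩
    -- if `x_j ∈ z` then `y'` lies on the strict transform of `D_{lab j}`, whose label is not in the new cone
    refine (famMap_spec c S hS).2.2.2 i j z fun hXj => ?_
    · have hfc : famChart c S hS i e ∈ newCharts 𝒞 C mv := Or.inl ⟨c, hc, S, hS, i, e, hJe, rfl⟩
      have hstrict : (famChart c S hS i e).img (newD s D C mv (c.lab (j : L))) = Ideal.span {MvPolynomial.X (j : L)} := by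
        have := G.img_newD hm hs hmv hfc (j : L)
        rwa [famChart_lab_of_ne c S hS i e (fun h => hij (Subtype.ext h.symm))] at this
      have h2 : famMap c S hS i z ∈ (newD s D C mv (c.lab (j : L))).support := by
        rw [Chart.ofMap_mem_support_iff (Function.update c.lab i e), ← famChart, hstrict,
          Ideal.span_singleton_le_iff_mem]
        exact hXj
      have := H _ h2
      rw [cone_famChart c (G.lab_inj c hc) S hS j e, Finset.mem_insert, Finset.mem_erase] at this
      rcases this with h | ⟨h, -⟩
      · exact G.name_not_mem_B hm hs hmv hJe (h ▸ G.lab_mem_B hm hs hmv hc (j : L))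
      · exact h rfl
  · have hcc' : (∃ S' hS' j' e', (c.labels S', e') ∈ mv ∧ liftChart c htop = famChart c S' hS' j' e') ∨
        ∃ htop', liftChart c htop = liftChart c htop' := Or.inr ⟨htop, rfl⟩
    have hy : blowup.π C y' ∈ (c.U : Y.Opens) :=
      (G.mem_U_iff c hc _).mpr fun l hl => G.mem_cone_of_forall_newD hm hs hmv
        (Or.inr ⟨c, hc, htop, rfl⟩) hcc' hc H hl
    haveI := (liftMap_spec c htop).1
    rw [liftChart, Chart.mem_ofMap_U_iff]
    exact (liftMap_spec c htop).2.2 y' hy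

end Img

end RouteK

end PolyhedraGame

end Summit.ResolutionOfSingularities.ResolutionOfSingularities.Theorems

end
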